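import Literature.NumberTheory.PAdicHodge.UnramifiedCompletionEmbedding
import Literature.NumberTheory.GaloisRepresentations.LubinTateTorsion
import Literature.NumberTheory.GaloisRepresentations.LocalFieldPadicProofs
import Mathlib.NumberTheory.Padics.Complex
import HarnessLib

/-!
# The embedding `𝒪̂_{F_nr} → T` into ANY `ϖ`-adically complete target, and `𝒪̂_{ℚ_p^nr} → 𝓞_{ℂ_p} ⊂ ℂ_p`
# for MATHLIB's `p`-adic complex numbers `ℂ_[p]`

Topic `NumberTheory/PAdicHodge`; namespace `Literature.NumberTheory.PAdicHodge`. Cell `bsd-print-cf2` (HOME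
`run/shared/lean/pub/bsd-print-cf2/`), seat `bsd-line-cf2-p1-w7` g7, planner g20's assignment (2026-08-29T11:51:38Z /
11:54:52Z): **GAP-2** of cf2c-w4 g5's `Cruxes/TwoVariableMainConjAtSplitTwoQuad/ASSEMBLY-GUIDE-measure-side-w4g5.md`
§0 — «the ring map `𝐃 = 𝒪̂_{F^nr} → ℂ_[2]` … with the coefficient bound `‖[S^m]H_β‖ ≤ 1`». WHY ℂ_[p] AND NOT THE
TREE'S `ℂ_F`: the measure-side theorems to be fed (`PAdicOneVariableTraceCriterion*.lean`, the `invAmice₁`/density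
stack) are generic over `[NormedField 𝕜] [NormedAlgebra ℚ_[p] 𝕜] [IsUltrametricDist 𝕜] [CompleteSpace 𝕜]`; the tree's
`CompletedAlgClosure ℚ_[p]` carries the norm of `rankOneValued` (an unspecified rank-one embedding of the value
group, `InertiaRootsOfUnity.lean`), so it is NOT a normed `ℚ_[p]`-algebra for Mathlib's `p`-adic norm, whereas
Mathlib's `ℂ_[p] = PadicComplex p` is. Hence the Coleman series `H_β ∈ 𝐃⟦S⟧` must be read in `ℂ_[p]` through

  `maxUnramifiedCompletion.toPadicComplex p : 𝒪̂_{ℚ_p^nr} →+* ℂ_[p]`,  `‖toPadicComplex p x‖ ≤ 1`.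

The construction is the tree's own (`UnramifiedCompletionEmbedding.lean`: `maxUnramifiedCompletion.toC` by
Mathlib's `IsAdicComplete.liftRingHom`), here ABSTRACTED over the target:

* §1 **`maxUnramifiedCompletion.liftOfIntegers`** — for any commutative ring `T`, ideal `J` with
  `IsAdicComplete J T`, and `φ₀ : 𝒪_{F_nr} →+* T` with `φ₀(ϖ_F) ∈ J`: the unique continuous extension
  `𝒪̂_{F_nr} →+* T` of `φ₀` (`famOfIntegers`, `famOfIntegers_compat`, `mk_liftOfIntegers`, `liftOfIntegers_algebraMap`).
* §2 `LubinTate.unitBall L` (the tree's `{‖x‖ ≤ 1}` of a complete ultrametric field `L`) is `u`-adically complete and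
  separated for `0 < ‖u‖ < 1` (`mem_span_pow_unitBall_iff`, `isAdicComplete_unitBall_span`) — the tree's
  `isAdicComplete_integerC` for any `L`.
* §3 `F = ℚ_p`: `ofMaxUnramifiedIntegersPadic : 𝒪_{ℚ_p^nr} →+* unitBall ℂ_[p]` (`PadicAlgCl p = AlgebraicClosure ℚ_[p]`
  definitionally; integral over `ℤ_p` ⇒ spectral norm `≤ 1`, tree `mem_absIntegers_iff_spectralNorm_le_one`),
  **`maxUnramifiedCompletion.toPadicComplexInt`**, **`maxUnramifiedCompletion.toPadicComplex`**,
  `norm_toPadicComplex_le_one`, `toPadicComplex_algebraMap'` (extends `𝒪_{ℚ_p^nr} ⊂ ℚ̄_p ⊂ ℂ_p`),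
  `toPadicComplex_algebraMap` (restricts to `ℤ_p = 𝒪[ℚ_[p]] → ℂ_[p]`).

HONEST FRAMING: plumbing (four `def`s with their unfolding lemmas; review lane); nothing about elliptic curves;
BSD is not advanced by this file.

## References
* [SerreLocalFields1979] J.-P. Serre, *Local Fields*, Ch. II §3–§5 (`𝒪̂_{F_nr} = W(k̄) ⊗ 𝒪_F ⊆ 𝒪_ℂ`).
* [FontaineOuyang2022] J.-M. Fontaine, Y. Ouyang, *Theory of p-adic Galois representations*, §3.1 (`K̂^{nr} ⊆ C`).
-/

noncomputable section

open ValuativeRel Field UniformSpace IsLocalRing AdicCompletion Filter Topology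

namespace Literature.NumberTheory.PAdicHodge

open Literature.NumberTheory.GaloisRepresentations
open Literature.NumberTheory.GaloisRepresentations.IsNonarchimedeanLocalField

/-! ### §1. The universal property of `𝒪̂_{F_nr}` relative to `𝒪_{F_nr}`: lifting into any `ϖ`-adically complete ring -/

section Lift

variable {F : Type} [Field F] [ValuativeRel F] [TopologicalSpace F] [IsNonarchimedeanLocalField F]
variable {T : Type*} [CommRing T] (J : Ideal T)
  (φ₀ : maxUnramifiedIntegers F →+* T) {ϖ : 𝒪[F]} (hϖ : Irreducible ϖ)
  (hJ : φ₀ (algebraMap 𝒪[F] (maxUnramifiedIntegers F) ϖ) ∈ J)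

include hϖ hJ in
/-- `𝔪^n ≤ J^n` pulled back along `φ₀ : 𝒪_{F_nr} → T` (`𝔪 = (ϖ)`, `φ₀(ϖ) ∈ J`). [cite: SerreLocalFields1979, Ch. II §5] -/
theorem maximalIdeal_pow_le_comap_of_mem (n : ℕ) :
    maximalIdeal (maxUnramifiedIntegers F) ^ n ≤ (J ^ n).comap φ₀ := by
  rw [maximalIdeal_eq_span_uniformizer hϖ, Ideal.span_singleton_pow, Ideal.span_le, Set.singleton_subset_iff,
    SetLike.mem_coe, Ideal.mem_comap, map_pow]
  exact Ideal.pow_mem_pow hJ n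

/-- **The compatible family** `𝒪̂_{F_nr} → 𝒪_{F_nr}/𝔪ⁿ → T/Jⁿ` induced by `φ₀`. [cite: SerreLocalFields1979, Ch. II §5] -/
def famOfIntegers (n : ℕ) : maxUnramifiedCompletion F →+* T ⧸ J ^ n :=
  (Ideal.quotientMap (J ^ n) φ₀ (maximalIdeal_pow_le_comap_of_mem J φ₀ hϖ hJ n)).comp
    (evalₐ (maximalIdeal (maxUnramifiedIntegers F)) n).toRingHom

/-- Unfolding of `famOfIntegers`. [cite: SerreLocalFields1979, Ch. II §5] -/
theorem famOfIntegers_apply (n : ℕ) (x : maxUnramifiedCompletion F) :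
    famOfIntegers J φ₀ hϖ hJ n x = Ideal.quotientMap (J ^ n) φ₀ (maximalIdeal_pow_le_comap_of_mem J φ₀ hϖ hJ n)
      (evalₐ (maximalIdeal (maxUnramifiedIntegers F)) n x) := rfl

/-- The family is compatible with the transition maps `T/Jⁿ → T/Jᵐ`. [cite: SerreLocalFields1979, Ch. II §5] -/
theorem famOfIntegers_compat {m n : ℕ} (hle : m ≤ n) :
    (Ideal.Quotient.factorPow J hle).comp (famOfIntegers J φ₀ hϖ hJ n) = famOfIntegers J φ₀ hϖ hJ m := by
  refine RingHom.ext fun x => ?_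
  rw [RingHom.comp_apply, famOfIntegers_apply, famOfIntegers_apply, ← factorPow_evalₐ _ hle x]
  generalize evalₐ (maximalIdeal (maxUnramifiedIntegers F)) n x = q
  induction q using Quotient.inductionOn' with
  | h r => rfl

variable [IsAdicComplete J T]

/-- **`𝒪̂_{F_nr} → T`, the lift of the compatible family** (universal property of the `J`-adically complete
ring `T`, Mathlib `IsAdicComplete.liftRingHom`): the continuous extension of `φ₀ : 𝒪_{F_nr} → T`.
[cite: SerreLocalFields1979, Ch. II §5] -/
def maxUnramifiedCompletion.liftOfIntegers : maxUnramifiedCompletion F →+* T :=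
  IsAdicComplete.liftRingHom J (famOfIntegers J φ₀ hϖ hJ) (fun hle => famOfIntegers_compat J φ₀ hϖ hJ hle)

/-- The defining congruences: `lift x ≡ famOfIntegers n x (mod Jⁿ)`. [cite: SerreLocalFields1979, Ch. II §5] -/
theorem mk_liftOfIntegers (n : ℕ) (x : maxUnramifiedCompletion F) :
    Ideal.Quotient.mk (J ^ n) (maxUnramifiedCompletion.liftOfIntegers J φ₀ hϖ hJ x) = famOfIntegers J φ₀ hϖ hJ n x :=
  IsAdicComplete.mk_liftRingHom J (famOfIntegers J φ₀ hϖ hJ) (fun hle => famOfIntegers_compat J φ₀ hϖ hJ hle) n x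

omit [IsNonarchimedeanLocalField F] [TopologicalSpace F] in
/-- Two elements of the `J`-adically separated ring `T` congruent modulo every `Jⁿ` are equal. [cite: SerreLocalFields1979, Ch. II §5] -/
theorem eq_of_forall_mk_pow_eq {x y : T} (h : ∀ n, Ideal.Quotient.mk (J ^ n) x = Ideal.Quotient.mk (J ^ n) y) :
    x = y := by
  rw [← sub_eq_zero]
  refine IsHausdorff.haus (IsAdicComplete.toIsHausdorff (I := J)) (x - y) fun n => ?_
  rw [SModEq.zero, Ideal.smul_eq_mul, Ideal.mul_top, ← Ideal.Quotient.eq_zero_iff_mem, map_sub, sub_eq_zero]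
  exact h n

/-- **The lift extends `φ₀`**: `lift (b) = φ₀ b` for `b ∈ 𝒪_{F_nr}`. [cite: SerreLocalFields1979, Ch. II §5] -/
theorem liftOfIntegers_algebraMap (b : maxUnramifiedIntegers F) :
    maxUnramifiedCompletion.liftOfIntegers J φ₀ hϖ hJ
        (algebraMap (maxUnramifiedIntegers F) (maxUnramifiedCompletion F) b) = φ₀ b := by
  refine eq_of_forall_mk_pow_eq J fun n => ?_
  rw [mk_liftOfIntegers, famOfIntegers_apply, AdicCompletion.algebraMap_apply, Algebra.algebraMap_self,
    RingHom.id_apply, evalₐ_of, Ideal.quotientMap_mk]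

end Lift

/-! ### §2. The closed unit ball of a complete ultrametric field is `u`-adically complete (`0 < ‖u‖ < 1`) -/

section UnitBall

open Literature.NumberTheory.GaloisRepresentations.LubinTate

variable {L : Type*} [NontriviallyNormedField L] [IsUltrametricDist L] [CompleteSpace L]

omit [CompleteSpace L] in
/-- **`(u)^n = {‖x‖ ≤ ‖u‖^n}`** in the unit ball `{‖x‖ ≤ 1}` of `L`, for `u ≠ 0`. [cite: FontaineOuyang2022, §3.1] -/
theorem mem_span_pow_unitBall_iff {u : unitBall L} (hu : (u : L) ≠ 0) (n : ℕ) (x : unitBall L) :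
    x ∈ Ideal.span {u} ^ n ↔ ‖(x : L)‖ ≤ ‖(u : L)‖ ^ n := by
  rw [Ideal.span_singleton_pow, Ideal.mem_span_singleton]
  constructor
  · rintro ⟨y, rfl⟩
    rw [Subring.coe_mul, SubmonoidClass.coe_pow, norm_mul, norm_pow]
    exact mul_le_of_le_one_right (pow_nonneg (norm_nonneg _) n) ((mem_unitBall_iff L).mp y.2)
  · intro hx
    have hun : ((u : L)) ^ n ≠ 0 := pow_ne_zero n hu
    refine ⟨⟨(x : L) / (u : L) ^ n, ?_⟩, ?_⟩
    · rw [mem_unitBall_iff, norm_div, norm_pow, div_le_one (by rw [← norm_pow]; exact norm_pos_iff.mpr hun)]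
      exact hx
    · apply Subtype.ext
      rw [Subring.coe_mul, SubmonoidClass.coe_pow]
      change (x : L) = (u : L) ^ n * ((x : L) / (u : L) ^ n)
      rw [mul_div_cancel₀ _ hun]

omit [CompleteSpace L] in
/-- The unit ball is closed. [cite: SerreLocalFields1979, Ch. II §5] -/
theorem isClosed_unitBall : IsClosed ((unitBall L : Subring L) : Set L) := by
  have : ((unitBall L : Subring L) : Set L) = Metric.closedBall 0 1 := by
    ext x; simp [mem_unitBall_iff]
  rw [this]; exact Metric.isClosed_closedBall

/-- **The unit ball `{‖x‖ ≤ 1}` of a complete ultrametric field is `u`-adically complete and separated** for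
`0 < ‖u‖ < 1`: a `u`-adically Cauchy sequence is Cauchy for the norm (`(u)^n = {‖x‖ ≤ ‖u‖^n}`), `L` is complete and
the unit ball is closed (the tree's `isAdicComplete_integerC`, any `L`). [cite: FontaineOuyang2022, §3.1] -/
theorem isAdicComplete_unitBall_span {u : unitBall L} (hu0 : (u : L) ≠ 0) (hu1 : ‖(u : L)‖ < 1) :
    IsAdicComplete (Ideal.span {u}) (unitBall L) := by
  set r : ℝ := ‖(u : L)‖ with hr
  have hr0 : 0 < r := norm_pos_iff.mpr hu0
  have hmem : ∀ (n : ℕ) (x : unitBall L),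
      x ∈ ((Ideal.span {u} ^ n) • ⊤ : Submodule (unitBall L) (unitBall L)) ↔ ‖(x : L)‖ ≤ r ^ n := by
    intro n x; rw [Ideal.smul_eq_mul, Ideal.mul_top, mem_span_pow_unitBall_iff hu0]
  haveI : IsHausdorff (Ideal.span {u}) (unitBall L) := ⟨fun x hx => ?hausdorff⟩
  case hausdorff =>
    apply Subtype.ext
    change (x : L) = 0
    have hle : ∀ n : ℕ, ‖(x : L)‖ ≤ r ^ n := fun n => by
      have := hx n
      rw [SModEq.zero] at this
      exact (hmem n x).mp this
    have hlim : Tendsto (fun n : ℕ => r ^ n) atTop (𝓝 0) := tendsto_pow_atTop_nhds_zero_of_lt_one hr0.le hu1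
    have h0 : ‖(x : L)‖ ≤ 0 := ge_of_tendsto' hlim hle
    exact norm_le_zero_iff.mp h0
  haveI : IsPrecomplete (Ideal.span {u}) (unitBall L) := ⟨fun f hf => ?prec⟩
  case prec =>
    have hdiff : ∀ {m n : ℕ}, m ≤ n → ‖(f m : L) - (f n : L)‖ ≤ r ^ m := by
      intro m n hmn
      have h := hf hmn
      rw [SModEq.sub_mem] at h
      exact (hmem m (f m - f n)).mp h
    have hcauchy : CauchySeq fun n => (f n : L) := by
      refine Metric.cauchySeq_iff'.mpr fun ε hε => ?_
      obtain ⟨N, hN⟩ := ((tendsto_pow_atTop_nhds_zero_of_lt_one hr0.le hu1).eventually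
        (gt_mem_nhds hε)).exists
      refine ⟨N, fun n hn => ?_⟩
      rw [dist_eq_norm, norm_sub_rev]
      exact (hdiff hn).trans_lt hN
    obtain ⟨Lim, hL⟩ := cauchySeq_tendsto_of_complete hcauchy
    have hLmem : Lim ∈ unitBall L :=
      isClosed_unitBall.mem_of_tendsto hL (Eventually.of_forall fun n => (f n).2)
    refine ⟨⟨Lim, hLmem⟩, fun n => ?_⟩
    rw [SModEq.sub_mem, hmem]
    change ‖(f n : L) - Lim‖ ≤ r ^ n
    have hcont : Tendsto (fun k => ‖(f n : L) - (f k : L)‖) atTop (𝓝 ‖(f n : L) - Lim‖) :=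
      ((continuous_norm.comp (continuous_const.sub continuous_id)).tendsto Lim).comp hL
    exact le_of_tendsto hcont (eventually_atTop.mpr ⟨n, fun k hk => hdiff hk⟩)
  exact IsAdicComplete.mk

end UnitBall

/-! ### §3. `F = ℚ_p`: `𝒪̂_{ℚ_p^nr} → 𝓞_{ℂ_p} ⊂ ℂ_[p]` (Mathlib's `PadicComplex`) -/

section Padic

open Literature.NumberTheory.GaloisRepresentations.LubinTate

variable (p : ℕ) [Fact p.Prime]

/-- An element of `𝒪_{ℚ_p^nr} ⊆ ℚ̄_p` (integral over `ℤ_p = 𝒪[ℚ_[p]]`) has `p`-adic (spectral) norm `≤ 1` in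
`PadicAlgCl p = ℚ̄_p`. [cite: SerreLocalFields1979, Ch. II §5] -/
theorem norm_coe_maxUnramifiedIntegers_padic_le_one
    (b : haveI := Padic.isNonarchimedeanLocalField_holds p; maxUnramifiedIntegers ℚ_[p]) :
    ‖((haveI := Padic.isNonarchimedeanLocalField_holds p; (b : AlgebraicClosure ℚ_[p])) : PadicAlgCl p)‖ ≤ 1 := by
  haveI := Padic.isNonarchimedeanLocalField_holds p
  have hb := mem_absIntegers_of_mem b.2
  have hw : ∀ x : ℚ_[p], valuation ℚ_[p] x ≤ 1 ↔ ‖x‖ ≤ 1 := fun x =>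
    (Valuation.mem_integer_iff _ _).symm.trans (Padic.mem_valuationInteger_iff p x)
  exact (mem_absIntegers_integer_iff_spectralNorm_le_one hw _).mp hb

/-- **`𝒪_{ℚ_p^nr} → 𝓞_{ℂ_p}`**: the inclusion `𝒪_{ℚ_p^nr} ⊆ ℚ̄_p ⊆ ℂ_p` corestricted to the unit ball of `ℂ_[p]`.
[cite: SerreLocalFields1979, Ch. II §5] -/
def ofMaxUnramifiedIntegersPadic :
    haveI := Padic.isNonarchimedeanLocalField_holds p
    maxUnramifiedIntegers ℚ_[p] →+* unitBall ℂ_[p] :=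
  haveI := Padic.isNonarchimedeanLocalField_holds p
  (((algebraMap (PadicAlgCl p) ℂ_[p]).comp (maxUnramifiedIntegers ℚ_[p]).toSubring.subtype)).codRestrict
    (unitBall ℂ_[p]) fun b => by
      rw [mem_unitBall_iff]
      change ‖((b : PadicAlgCl p) : ℂ_[p])‖ ≤ 1
      rw [PadicComplex.norm_extends]
      exact norm_coe_maxUnramifiedIntegers_padic_le_one p b

/-- Unfolding of `ofMaxUnramifiedIntegersPadic` in `ℂ_[p]`. [cite: SerreLocalFields1979, Ch. II §5] -/
theorem coe_ofMaxUnramifiedIntegersPadic (b : haveI := Padic.isNonarchimedeanLocalField_holds p; maxUnramifiedIntegers ℚ_[p]) :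
    haveI := Padic.isNonarchimedeanLocalField_holds p
    ((ofMaxUnramifiedIntegersPadic p b : unitBall ℂ_[p]) : ℂ_[p]) = ((b : PadicAlgCl p) : ℂ_[p]) := rfl

/-- `p` as an element of the unit ball of `ℂ_[p]`. [cite: SerreLocalFields1979, Ch. II §5] -/
theorem natCast_mem_unitBall : ((p : ℂ_[p])) ∈ unitBall ℂ_[p] := by
  rw [mem_unitBall_iff, ← map_natCast (algebraMap ℚ_[p] ℂ_[p]) p]
  change ‖((p : ℚ_[p]) : ℂ_[p])‖ ≤ 1
  rw [PadicComplex.norm_extends']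
  exact (Padic.norm_p_lt_one (p := p)).le

/-- `ofMaxUnramifiedIntegersPadic` sends `p ∈ 𝒪[ℚ_[p]]` to `p`. [cite: SerreLocalFields1979, Ch. II §5] -/
theorem ofMaxUnramifiedIntegersPadic_natCast :
    haveI := Padic.isNonarchimedeanLocalField_holds p
    ofMaxUnramifiedIntegersPadic p (algebraMap 𝒪[ℚ_[p]] (maxUnramifiedIntegers ℚ_[p]) (p : 𝒪[ℚ_[p]])) =
      ⟨(p : ℂ_[p]), natCast_mem_unitBall p⟩ := by
  haveI := Padic.isNonarchimedeanLocalField_holds p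
  apply Subtype.ext
  rw [coe_ofMaxUnramifiedIntegersPadic, map_natCast]
  push_cast
  rfl

/-- The unit ball of `ℂ_[p]` is `p`-adically complete and separated. [cite: FontaineOuyang2022, §3.1] -/
theorem isAdicComplete_unitBall_padicComplex :
    IsAdicComplete (Ideal.span {(⟨(p : ℂ_[p]), natCast_mem_unitBall p⟩ : unitBall ℂ_[p])}) (unitBall ℂ_[p]) := by
  refine isAdicComplete_unitBall_span ?_ ?_
  · change (p : ℂ_[p]) ≠ 0
    exact Nat.cast_ne_zero.mpr (Fact.out : p.Prime).ne_zero
  · change ‖(p : ℂ_[p])‖ < 1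
    rw [← map_natCast (algebraMap ℚ_[p] ℂ_[p]) p]
    change ‖((p : ℚ_[p]) : ℂ_[p])‖ < 1
    rw [PadicComplex.norm_extends']
    exact Padic.norm_p_lt_one (p := p)

/-- **`𝒪̂_{ℚ_p^nr} → 𝓞_{ℂ_p}`** (the unit ball of Mathlib's `ℂ_[p]`): the `p`-adically continuous extension of
`𝒪_{ℚ_p^nr} ⊆ 𝓞_{ℂ_p}` (§1 with `T` the unit ball of `ℂ_[p]`, `J = (p)`). [cite: SerreLocalFields1979, Ch. II §5] -/
def maxUnramifiedCompletion.toPadicComplexInt :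
    haveI := Padic.isNonarchimedeanLocalField_holds p
    maxUnramifiedCompletion ℚ_[p] →+* unitBall ℂ_[p] :=
  haveI := Padic.isNonarchimedeanLocalField_holds p
  haveI := isAdicComplete_unitBall_padicComplex p
  maxUnramifiedCompletion.liftOfIntegers (Ideal.span {(⟨(p : ℂ_[p]), natCast_mem_unitBall p⟩ : unitBall ℂ_[p])})
    (ofMaxUnramifiedIntegersPadic p) (Padic.irreducible_natCast_valuationInteger p)
    (by rw [ofMaxUnramifiedIntegersPadic_natCast]; exact Ideal.mem_span_singleton_self _)

/-- **`𝒪̂_{ℚ_p^nr} → ℂ_[p]`** — the ring map `𝐃 → ℂ_p` through which a series `H ∈ 𝐃⟦S⟧` is read on the measure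
side (`PowerSeries.map`). [cite: SerreLocalFields1979, Ch. II §5] [cite: FontaineOuyang2022, §3.1] -/
def maxUnramifiedCompletion.toPadicComplex :
    haveI := Padic.isNonarchimedeanLocalField_holds p
    maxUnramifiedCompletion ℚ_[p] →+* ℂ_[p] :=
  haveI := Padic.isNonarchimedeanLocalField_holds p
  (unitBall ℂ_[p]).subtype.comp (maxUnramifiedCompletion.toPadicComplexInt p)

/-- **The coefficient bound**: `‖toPadicComplex p x‖ ≤ 1` for every `x ∈ 𝒪̂_{ℚ_p^nr}` (it lands in the unit ball),
so `‖[S^m](H.map (toPadicComplex p))‖ ≤ 1` for every `H ∈ 𝐃⟦S⟧`. [cite: FontaineOuyang2022, §3.1] -/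
theorem norm_toPadicComplex_le_one (x : haveI := Padic.isNonarchimedeanLocalField_holds p; maxUnramifiedCompletion ℚ_[p]) :
    haveI := Padic.isNonarchimedeanLocalField_holds p
    ‖maxUnramifiedCompletion.toPadicComplex p x‖ ≤ 1 := by
  haveI := Padic.isNonarchimedeanLocalField_holds p
  exact (mem_unitBall_iff ℂ_[p]).mp (maxUnramifiedCompletion.toPadicComplexInt p x).2

/-- The coefficient bound for a mapped power series. [cite: FontaineOuyang2022, §3.1] -/
theorem norm_coeff_map_toPadicComplex_le_one
    (H : haveI := Padic.isNonarchimedeanLocalField_holds p; PowerSeries (maxUnramifiedCompletion ℚ_[p])) (m : ℕ) :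
    haveI := Padic.isNonarchimedeanLocalField_holds p
    ‖PowerSeries.coeff m (PowerSeries.map (maxUnramifiedCompletion.toPadicComplex p) H)‖ ≤ 1 := by
  haveI := Padic.isNonarchimedeanLocalField_holds p
  rw [PowerSeries.coeff_map]
  exact norm_toPadicComplex_le_one p _

/-- **`toPadicComplex` extends the inclusion `𝒪_{ℚ_p^nr} ⊆ ℚ̄_p ⊆ ℂ_p`.** [cite: SerreLocalFields1979, Ch. II §5] -/
theorem toPadicComplex_algebraMap' (b : haveI := Padic.isNonarchimedeanLocalField_holds p; maxUnramifiedIntegers ℚ_[p]) :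
    haveI := Padic.isNonarchimedeanLocalField_holds p
    maxUnramifiedCompletion.toPadicComplex p
        (algebraMap (maxUnramifiedIntegers ℚ_[p]) (maxUnramifiedCompletion ℚ_[p]) b) =
      ((b : PadicAlgCl p) : ℂ_[p]) := by
  haveI := Padic.isNonarchimedeanLocalField_holds p
  haveI := isAdicComplete_unitBall_padicComplex p
  change ((maxUnramifiedCompletion.toPadicComplexInt p
    (algebraMap (maxUnramifiedIntegers ℚ_[p]) (maxUnramifiedCompletion ℚ_[p]) b) : unitBall ℂ_[p]) : ℂ_[p]) = _
  rw [maxUnramifiedCompletion.toPadicComplexInt, liftOfIntegers_algebraMap]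
  rfl

/-- On `ℤ_p = 𝒪[ℚ_[p]]`, `toPadicComplex` is the inclusion `ℚ_p ⊆ ℂ_p`. [cite: SerreLocalFields1979, Ch. II §5] -/
theorem toPadicComplex_algebraMap (a : 𝒪[ℚ_[p]]) :
    haveI := Padic.isNonarchimedeanLocalField_holds p
    maxUnramifiedCompletion.toPadicComplex p
        (algebraMap 𝒪[ℚ_[p]] (maxUnramifiedCompletion ℚ_[p]) a) = ((a : ℚ_[p]) : ℂ_[p]) := by
  haveI := Padic.isNonarchimedeanLocalField_holds p
  rw [IsScalarTower.algebraMap_apply 𝒪[ℚ_[p]] (maxUnramifiedIntegers ℚ_[p]) (maxUnramifiedCompletion ℚ_[p]),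
    toPadicComplex_algebraMap', coe_algebraMap_maxUnramifiedIntegers,
    IsScalarTower.algebraMap_apply 𝒪[ℚ_[p]] ℚ_[p] (AlgebraicClosure ℚ_[p])]
  rfl

end Padic

end Literature.NumberTheory.PAdicHodge

end
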